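import Literature.NumberTheory.EllipticCurves.CongruenceVisibilityComparison
import HarnessLib

/-!
# Visible elements of `Ш(E/K)[p]` from a `p`-congruent curve — the EXPLICIT-WITNESS form
# (cell `b2b-bsdres`, team n1011, seat p09 GEN 9; row T-VIS3-W = r1 ROUTE-1 §40.3 (d) "T-VIS3⁺";
# skeleton `cells/n1011/skel/T-VIS3-W.md`)

HONEST FRAMING (cell `b2b-bsdres`, run/shared/lean/b2b/bsd-rank1-residual/, verbatim in every
file): the goal of the cell is to DELETE the COMBINATION-SHAPED residual classes of the
Birch–Swinnerton-Dyer formula for ALL analytic-rank `≤ 1` elliptic curves over `ℚ` — "full BSD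
formula for every rank `≤ 1` curve in class `C`" assembled STRICTLY from published theorems — so
that the rank-`≤ 1` remainder becomes exactly the CONSTRUCTION-SHAPED classes, which are TYPED
(missing-input `Prop`s), NOT attempted. This is not "finishing BSD". Team n1011 (N10 / N11):
research route on the CONSTRUCTION-SHAPED class X4; no claim beyond the stated classes; nothing is
booked; marks UNCHANGED. Theorems only: no definition, no named fact, no `sorry`. The theorems
below are TOOL theorems (general number field `K`, odd prime `p`); they close nothing by
themselves — the congruence `θ`, the witness point and its local divisibility are INPUTS.

## What and why

The tree's visibility engine (`Literature/NumberTheory/EllipticCurves/CongruenceVisibility*.lean`: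
`WeierstrassCurve.exists_sha_ne_zero_of_congr_of_index_lt`, `…_of_congr`, `…_of_congr_of_rank`,
`…_of_relIndex_lt`, `…_of_le_off`, `…_of_places`, …) proves `Ш(E/K)[p] ≠ 0` from a
`Γ_K`-isomorphism `θ : E'[p] ⥲ E[p]` by a COUNT: the source is all of `E'(K)/pE'(K)` and every place
`v ∈ S` is either paid for (factor `#𝓛_v(E') = #E'(K_v)[p] · #(𝓞_v/p)`) or shown to have
comparison index `ι_v(θ) = 1`. At a place `v ∣ p` the count pays at least `p^{[K_v:ℚ_p]}`, and
`p^{[K_v:ℚ_p]} · #E'(K_v)[p]` when `E'` has `K_v`-rational `p`-torsion; over `ℚ` at `p = 3` with a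
rank-`2` partner this is `9 ≮ 9`, and `ι_3(θ) = 1` is in print only for potentially multiplicative
pairs (Mazur–Rubin 2015, Thm. 3.1) — for potentially good additive pairs it is an open problem
(loc. cit. p. 402).

This file states the ORIGINAL, explicit shape of visibility (Cremona–Mazur 2000 §3: a named subgroup
of `E'(ℚ)` becomes visible in `Ш(E)`; Agashe–Stein 2002 Lemma 3.6), which the count replaces by a
pigeonhole: NAME a point `P ∈ E'(K) ∖ pE'(K)` and ask that its transported Kummer class
`θ_* κ'(P)` satisfy the local condition of `E` at every `v ∈ S`; the explaining class is
`f(P) = (H¹(K,E[p]) → H¹(K,E)) (θ_* κ'(P))` itself and NO index appears. The point is criterion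
(a): **if `P` is `p`-DIVISIBLE in `E'(K_v)` then `res_v κ'(P) = 0` outright**
(`res_kummerMapTorsion_eq_zero_of_exists_smul_eq`), so `θ_* κ'(P)` satisfies the local condition
of `E` at `v` WHATEVER the reduction of `E` and `E'` at `v` — no comparison of local conditions at
the hard place. This is r1's "finite `3`-adic certificate" road (ROUTE-1 §40.3 (d), T-VIS3⁺).

* §1 Localisation of global Kummer classes at rational points (any field `K` of characteristic `0`,
  any `K`-field `L`): `res_kummerMapTorsion_eq_zero_of_exists_smul_eq` (criterion (a)) and the
  three sufficient criteria for `θ_* κ'(P) ∈ 𝓢_L(E)`: (a) local divisibility, (b) `#𝓛_L(E') = 1`,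
  (c) `ι_L(θ) = 1` (the tree's criteria of `CongruenceVisibilityComparison.lean` apply by name).
* §2 `torsionH1ToH1_h1Equiv_kummerMapTorsion_mem_sha` (the visible class of such a `P` lies in
  `Ш(E/K)[p]`) and `exists_sha_ne_zero_of_congr_of_witness` — the witness theorem: `E(K) = pE(K)`,
  `P ∈ E'(K) ∖ pE'(K)` with `θ_* κ'(P) ∈ 𝓢_v(E)` for all `v ∈ S` ⟹ `Ш(E/K)[p] ≠ 0`.
* §3 `exists_sha_ne_zero_of_congr_of_locallyDivisible` — the certificate shape: `E(K)` finite of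
  order prime to `p`, `P ∈ E'(K) ∖ pE'(K)`, and at each `v ∈ S` either a `p`-th root of `P` in
  `E'(K_v)` or (`v ∤ p` and `E'(K_v)[p] = 0`).

HONEST PRICE. The witness form bites on a pair only if the localisation `E'(K)/p → E'(K_v)/p` at the
hard places has a kernel meeting `E'(K) ∖ pE'(K)` (over `ℚ` at `3`: is `E'(ℚ)/3 → E'(ℚ₃)/3`
singular?) — a per-row computation, EVIDENCE, not made here; where that map is injective only the
comparison `ι_v(θ) = 1` (Mazur–Rubin / open) or another partner remains. LOWER half only.

References (provenance of the argument; every input used below is a theorem of the tree):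
[CremonaMazur2000] Experiment. Math. 9 (2000) 13–28, §3; [AgasheStein2002] J. Number Theory 97
(2002) 171–185, Lemma 3.6, Thm. 3.1; B. Mazur, K. Rubin, *Selmer companion curves*, Trans. AMS 367
(2015) 401–421, Thm. 3.1 and p. 402; [SilvermanAEC2009] VIII.§2, X.§4.
-/

noncomputable section

open scoped Classical

universe u

namespace Summit.BirchSwinnertonDyer.Rank1Residual.GaloisImage.VisibleWitness

open WeierstrassCurve Literature.NumberTheory.EllipticCurves Literature.NumberTheory.GaloisRepresentations
open Field NumberField IsDedekindDomain

/-! ## §1 Localisation of global Kummer classes at rational points -/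

section Localisation

variable {K : Type u} [Field K] (W : WeierstrassCurve K) (L : Type u) [Field L] [Algebra K L]

/-- Plumbing: an `L`-rational point `R` of `W⁄L`, sent to `geomPoints (W⁄L)` and read in
`E(K̄_L) = localPoints W L` through `baseChangeGeomPointsEquiv`, is `R` mapped along `L → K̄_L`. -/
theorem baseChangeGeomPointsEquiv_toGeomPoints (R : (W.baseChange L).toAffine.Point) :
    W.baseChangeGeomPointsEquiv L (toGeomPoints (W.baseChange L) R) =
      (WeierstrassCurve.Affine.Point.map (W' := W)
        (IsScalarTower.toAlgHom K L (AlgebraicClosure L)) R : localPoints W L) := by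
  rcases R with _ | ⟨x, y, h⟩
  · rfl
  · rfl

/-- Plumbing: `P ∈ E(K)` sent to `E(K̄)` and on to `E(K̄_L)` (`pointsMap`) is `P|_L` read in `E(K̄_L)`. -/
theorem pointsMap_toGeomPoints_eq (P : W.toAffine.Point) :
    pointsMap W L (toGeomPoints W P) =
      W.baseChangeGeomPointsEquiv L (toGeomPoints (W.baseChange L)
        (WeierstrassCurve.Affine.Point.baseChange (W' := W) K L P)) := by
  rw [baseChangeGeomPointsEquiv_toGeomPoints]
  change WeierstrassCurve.Affine.Point.map (closureEmb (K := K) L)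
      (WeierstrassCurve.Affine.Point.baseChange (W' := W) K (AlgebraicClosure K) P) =
    WeierstrassCurve.Affine.Point.map (W' := W) (IsScalarTower.toAlgHom K L (AlgebraicClosure L))
      (WeierstrassCurve.Affine.Point.baseChange (W' := W) K L P)
  rw [WeierstrassCurve.Affine.Point.map_baseChange, WeierstrassCurve.Affine.Point.map_baseChange]

/-- An `L`-rational point read in `E(K̄_L)` is fixed by `Γ_L`. [folklore] -/
theorem baseChangeGeomPointsEquiv_toGeomPoints_mem_fixedPoints (R : (W.baseChange L).toAffine.Point) :
    W.baseChangeGeomPointsEquiv L (toGeomPoints (W.baseChange L) R) ∈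
      MulAction.fixedPoints (absoluteGaloisGroup L) (localPoints W L) := by
  intro σ
  rw [← baseChangeGeomPointsEquiv_smul, smul_toGeomPoints]

variable [CharZero K] [W.IsElliptic] {n : ℤ}

/-- **Criterion (a): a rational point that is `n`-divisible in `E(L)` has Kummer class restricting to
ZERO in `H¹(L, E[n])`.** For `P ∈ E(K)` with `P|_L = n • Q`, `Q ∈ (W⁄L)(L)`: choose a global root
`R ∈ E(K̄)` of `P` (`zsmulRoot`); the restriction of `κ(P) = [σ ↦ σR − R]` to `Γ_L` is the local
Kummer class of `R` (tree `res_kummerClassTorsion`), and `R − Q` is an `n`-torsion point of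
`E(K̄_L)` with `R − (R − Q) = Q` fixed by `Γ_L`, so that class vanishes
(`localKummerClass_eq_zero_iff`). Silverman, *AEC*, X.§4 (commutativity of the Kummer diagram
(**)). -/
theorem res_kummerMapTorsion_eq_zero_of_exists_smul_eq (hn : n ≠ 0)
    (hdiv : ∀ P : geomPoints W, ∃ Q : geomPoints W, n • Q = P) (P : W.toAffine.Point)
    (h : ∃ Q : (W.baseChange L).toAffine.Point,
      n • Q = WeierstrassCurve.Affine.Point.baseChange (W' := W) K L P) :
    galoisCohomology.res (W.torsionGaloisModule n) L 1 (kummerMapTorsion W n hdiv P) = 0 := by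
  obtain ⟨Q, hQ⟩ := h
  have hR : n • zsmulRoot W n hdiv P = toGeomPoints W P := zsmul_zsmulRoot W n hdiv P
  rw [kummerMapTorsion_apply, kummerMapTorsionFun,
    res_kummerClassTorsion W n hn (zsmulRoot W n hdiv P) (zsmul_zsmulRoot_mem W n hdiv P)
      (zsmul_pointsMap_mem_fixedPoints W n _ (zsmul_zsmulRoot_mem W n hdiv P)),
    localKummerClass_eq_zero_iff]
  refine ⟨pointsMap W L (zsmulRoot W n hdiv P) -
      W.baseChangeGeomPointsEquiv L (toGeomPoints (W.baseChange L) Q), ?_, ?_⟩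
  · change n • (pointsMap W L (zsmulRoot W n hdiv P) -
        W.baseChangeGeomPointsEquiv L (toGeomPoints (W.baseChange L) Q)) = 0
    rw [zsmul_sub, ← map_zsmul, hR, pointsMap_toGeomPoints_eq, ← map_zsmul, ← map_zsmul, hQ,
      sub_self]
  · rw [sub_sub_cancel]
    exact baseChangeGeomPointsEquiv_toGeomPoints_mem_fixedPoints W L Q

omit [CharZero K] [W.IsElliptic] in
/-- **Criterion (b): if the local Kummer condition `𝓛_L(E)` is trivial, every global Kummer class
restricts to zero at `L`** (the restriction lies in `𝓛_L(E)`,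
`res_kummerMapTorsion_mem_kummerLocalConditionAt`). At a finite place `v ∤ p` of a number field,
`#𝓛_v(E) = #E(K_v)[p]` (`natCard_kummerLocalConditionAt_adicCompletion`,
`natCard_quot_adicCompletionIntegers_eq_one`). [folklore] -/
theorem res_kummerMapTorsion_eq_zero_of_natCard_kummerLocalConditionAt_eq_one
    (hdiv : ∀ P : geomPoints W, ∃ Q : geomPoints W, n • Q = P) (P : W.toAffine.Point)
    (h1 : Nat.card (W.kummerLocalConditionAt n L) = 1) :
    galoisCohomology.res (W.torsionGaloisModule n) L 1 (kummerMapTorsion W n hdiv P) = 0 := by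
  have hmem := res_kummerMapTorsion_mem_kummerLocalConditionAt W (E := L) hdiv P
  haveI : Subsingleton (W.kummerLocalConditionAt n L) := (Nat.card_eq_one_iff_unique.mp h1).1
  have h0 : (⟨_, hmem⟩ : W.kummerLocalConditionAt n L) = ⟨0, zero_mem _⟩ := Subsingleton.elim _ _
  exact congrArg Subtype.val h0

end Localisation

/-! ## §1 (continued) The three criteria for `θ_* κ'(P) ∈ 𝓢_L(E)` -/

section Criteria

variable {K : Type} [Field K] [CharZero K] (W W' : WeierstrassCurve K) [W'.IsElliptic] {n : ℤ}
  (θ : geomTorsion W' n ≃+ geomTorsion W n)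
  (hθ : ∀ (σ : absoluteGaloisGroup K) (P : geomTorsion W' n), θ (σ • P) = σ • θ P)
  (L : Type) [Field L] [Algebra K L]

/-- **Criterion (a), transported: a point of `E'(K)` that is `n`-divisible in `E'(L)` has
`θ_* κ'(P)` in the local Selmer condition `𝓢_L(E)` of `E`** (indeed restricting to zero at `L`;
`h1Equiv_mem_selmerLocalKer_of_res_eq_zero`). No hypothesis on the reduction of `E` or `E'`. -/
theorem h1Equiv_kummerMapTorsion_mem_selmerLocalKer_of_exists_smul_eq (hn : n ≠ 0)
    (hdiv' : ∀ P : geomPoints W', ∃ Q : geomPoints W', n • Q = P) (P : W'.toAffine.Point)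
    (h : ∃ Q : (W'.baseChange L).toAffine.Point,
      n • Q = WeierstrassCurve.Affine.Point.baseChange (W' := W') K L P) :
    h1Equiv θ hθ (kummerMapTorsion W' n hdiv' P) ∈ selmerLocalKer W L n :=
  h1Equiv_mem_selmerLocalKer_of_res_eq_zero W W' θ hθ L _
    (res_kummerMapTorsion_eq_zero_of_exists_smul_eq W' L hn hdiv' P h)

omit [CharZero K] [W'.IsElliptic] in
/-- **Criterion (b), transported: if `#𝓛_L(E') = 1` then `θ_* κ'(P) ∈ 𝓢_L(E)`** for every
`P ∈ E'(K)`. [folklore] -/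
theorem h1Equiv_kummerMapTorsion_mem_selmerLocalKer_of_natCard_eq_one
    (hdiv' : ∀ P : geomPoints W', ∃ Q : geomPoints W', n • Q = P) (P : W'.toAffine.Point)
    (h1 : Nat.card (W'.kummerLocalConditionAt n L) = 1) :
    h1Equiv θ hθ (kummerMapTorsion W' n hdiv' P) ∈ selmerLocalKer W L n :=
  h1Equiv_mem_selmerLocalKer_of_res_eq_zero W W' θ hθ L _
    (res_kummerMapTorsion_eq_zero_of_natCard_kummerLocalConditionAt_eq_one W' L hdiv' P h1)

omit [CharZero K] [W'.IsElliptic] in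
/-- **Criterion (c): if the local conditions agree along `θ` at `L` (`ι_L(θ) = 1`, i.e.
`θ_* 𝓢_L(E') ≤ 𝓢_L(E)`; tree `relIndex_map_selmerLocalKer_eq_one_iff` and its criteria
`…_of_hasGoodReductionAt`, `…_of_card_torsion_eq_one`, `…_of_hasSplitMultiplicativeReductionAt`, …)
then `θ_* κ'(P) ∈ 𝓢_L(E)`** for every `P ∈ E'(K)` (Kummer classes are Selmer everywhere,
`kummerMapTorsion_mem_selmerLocalKer`). [folklore] -/
theorem h1Equiv_kummerMapTorsion_mem_selmerLocalKer_of_relIndex_eq_one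
    (hdiv' : ∀ P : geomPoints W', ∃ Q : geomPoints W', n • Q = P) (P : W'.toAffine.Point)
    (h : (selmerLocalKer W L n).relIndex
      ((selmerLocalKer W' L n).map (h1Equiv θ hθ).toAddMonoidHom) = 1) :
    h1Equiv θ hθ (kummerMapTorsion W' n hdiv' P) ∈ selmerLocalKer W L n :=
  (relIndex_map_selmerLocalKer_eq_one_iff W W' θ hθ).mp h _
    (kummerMapTorsion_mem_selmerLocalKer W' n hdiv' L P)

end Criteria

/-! ## §2 The witness theorem -/

section Main

variable {K : Type} [Field K] [NumberField K] (W W' : WeierstrassCurve K) [W.IsElliptic]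
  [W'.IsElliptic] {p : ℕ} [Fact p.Prime]

/-- **The visible class of a point lies in `Ш(E/K)[p]`.** With `θ`, `S` as in
`exists_sha_ne_zero_of_congr_of_witness`: for ANY `P ∈ E'(K)` whose transported Kummer class
`θ_* κ'(P)` satisfies the local condition of `E` at every `v ∈ S`, the image
`f(P) = (H¹(K,E[p]) → H¹(K,E)) (θ_* κ'(P))` lies in `Ш(E/K)` and is killed by `p`: it is locally
trivial at `v ∈ S` by hypothesis, at `v ∉ S` because Kummer classes are unramified there and
unramifiedness passes through `θ` (`selmerLocalKer_eq_unramifiedKer`,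
`mem_unramifiedKer_iff_h1Equiv_mem`, `unramifiedKer_le_selmerLocalKer`), at `v ∣ ∞` because `p` is
odd (`two_nsmul_mem_localRestrictionKer_infinitePlace`); and `p • f(P) = f(pP) = 0`
(`kummerMapTorsion_ker`). This is step (4) of the tree's count
(`exists_sha_ne_zero_of_congr_of_index_lt`), isolated for a NAMED point. [folklore] -/
theorem torsionH1ToH1_h1Equiv_kummerMapTorsion_mem_sha (hp2 : p ≠ 2)
    (θ : geomTorsion W' (p : ℤ) ≃+ geomTorsion W (p : ℤ))
    (hθ : ∀ (σ : absoluteGaloisGroup K) (P : geomTorsion W' (p : ℤ)), θ (σ • P) = σ • θ P)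
    (S : Finset (HeightOneSpectrum (𝓞 K)))
    (hS : ∀ v : HeightOneSpectrum (𝓞 K), v ∉ S →
      W.HasGoodReductionAt v ∧ W'.HasGoodReductionAt v ∧ (p : 𝓞 K) ∉ v.asIdeal)
    (hdiv' : ∀ P : geomPoints W', ∃ Q : geomPoints W', (p : ℤ) • Q = P)
    (P : W'.toAffine.Point)
    (hloc : ∀ v ∈ S, h1Equiv θ hθ (kummerMapTorsion W' (p : ℤ) hdiv' P) ∈
      selmerLocalKer W (v.adicCompletion K) (p : ℤ)) :
    torsionH1ToH1 W (p : ℤ) (h1Equiv θ hθ (kummerMapTorsion W' (p : ℤ) hdiv' P)) ∈ W.sha ∧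
      p • torsionH1ToH1 W (p : ℤ) (h1Equiv θ hθ (kummerMapTorsion W' (p : ℤ) hdiv' P)) = 0 := by
  have hp : p.Prime := Fact.out
  -- the visibility map `f : E'(K) → H¹(K, E)` and the class `c = f(P)`
  set f : W'.toAffine.Point →+ W.galH1 := (torsionH1ToH1 W (p : ℤ)).comp
    ((h1Equiv θ hθ).toAddMonoidHom.comp (kummerMapTorsion W' (p : ℤ) hdiv')) with hf
  have hf_apply : ∀ P, f P =
      torsionH1ToH1 W (p : ℤ) (h1Equiv θ hθ (kummerMapTorsion W' (p : ℤ) hdiv' P)) := fun P ↦ rfl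
  rw [← hf_apply]
  set c := f P with hc
  have hpc : p • c = 0 := by
    have hmem : (p : ℤ) • P ∈ (kummerMapTorsion W' (p : ℤ) hdiv').ker := by
      rw [kummerMapTorsion_ker W' (p : ℤ) hdiv']
      exact ⟨P, rfl⟩
    rw [hc, ← natCast_zsmul, ← map_zsmul, hf_apply,
      show kummerMapTorsion W' (p : ℤ) hdiv' ((p : ℤ) • P) = 0 from hmem, map_zero, map_zero]
  refine ⟨?_, hpc⟩
  rw [mem_sha_iff]
  refine ⟨fun v ↦ ?_, fun w ↦ ?_⟩
  · rw [hc, hf_apply]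
    apply torsionH1ToH1_mem_localRestrictionKer
    by_cases hv : v ∈ S
    · -- `v ∈ S`: the hypothesis on the point
      exact hloc v hv
    · -- `v ∉ S`: good reduction of both curves and `v ∤ p`; Kummer classes are unramified
      obtain ⟨hgood, hgood', hpv⟩ := hS v hv
      have hpv' : ((p : ℤ) : 𝓞 K) ∉ v.asIdeal := by rwa [Int.cast_natCast]
      obtain ⟨𝔓, h𝔓⟩ := v.primesAbove_nonempty
      refine W.unramifiedKer_le_selmerLocalKer hgood hpv' h𝔓 ?_
      rw [← mem_unramifiedKer_iff_h1Equiv_mem, ← W'.selmerLocalKer_eq_unramifiedKer hgood' hpv' h𝔓]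
      exact kummerMapTorsion_mem_selmerLocalKer W' _ hdiv' _ P
  · -- infinite places: `2c ↦ 0` and `pc = 0` with `p` odd
    obtain ⟨k, hk⟩ := hp.odd_of_ne_two hp2
    have h2 := two_nsmul_mem_localRestrictionKer_infinitePlace W w c
    have hck : c = p • c - k • (2 • c) := by
      rw [hk, add_nsmul, one_nsmul, mul_nsmul, add_sub_cancel_left]
    rw [hck, hpc, zero_sub]
    exact neg_mem (AddSubgroup.nsmul_mem _ h2 k)

/-- **Visibility with an explicit witness.** Let `E = W`, `E' = W'` be elliptic curves over a
number field `K`, `p` an odd prime, `θ : E'[p] ⥲ E[p]` a `Γ_K`-equivariant isomorphism, `S` a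
finite set of finite places containing every place of bad reduction of `E` or `E'` and every place
above `p`. Suppose `E(K) = pE(K)` (e.g. `E(K)` finite of order prime to `p`) and let
`P ∈ E'(K) ∖ pE'(K)` be a point whose transported Kummer class `θ_* κ'(P)` satisfies the local
condition of `E` at every `v ∈ S` (criteria (a)/(b)/(c) of §1: `P` is `p`-divisible in `E'(K_v)`;
`#𝓛_v(E') = 1`; `ι_v(θ) = 1`). **Then `Ш(E/K)` has a non-zero element killed by `p`**, namely the
image `f(P)` of `θ_* κ'(P)` in `H¹(K, E)` (`torsionH1ToH1_h1Equiv_kummerMapTorsion_mem_sha`):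
`f(P) = 0` would put `θ_* κ'(P)` in the Kummer image of `E(K)`
(`mem_range_kummerMapTorsion_of_torsionH1ToH1_eq_zero`), which is `0` since `E(K) = pE(K)`,
forcing `κ'(P) = 0`, i.e. `P ∈ pE'(K)` (`kummerMapTorsion_ker`). No index and no count is used.
(Cremona–Mazur 2000 §3 / Agashe–Stein 2002 Lemma 3.6 in explicit form, at `p ∣ N` allowed.) -/
theorem exists_sha_ne_zero_of_congr_of_witness (hp2 : p ≠ 2)
    (θ : geomTorsion W' (p : ℤ) ≃+ geomTorsion W (p : ℤ))
    (hθ : ∀ (σ : absoluteGaloisGroup K) (P : geomTorsion W' (p : ℤ)), θ (σ • P) = σ • θ P)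
    (S : Finset (HeightOneSpectrum (𝓞 K)))
    (hS : ∀ v : HeightOneSpectrum (𝓞 K), v ∉ S →
      W.HasGoodReductionAt v ∧ W'.HasGoodReductionAt v ∧ (p : 𝓞 K) ∉ v.asIdeal)
    (hdiv' : ∀ P : geomPoints W', ∃ Q : geomPoints W', (p : ℤ) • Q = P)
    (hE : (zsmulAddGroupHom (p : ℤ) : W.toAffine.Point →+ W.toAffine.Point).range = ⊤)
    (P : W'.toAffine.Point)
    (hP : P ∉ (zsmulAddGroupHom (p : ℤ) : W'.toAffine.Point →+ W'.toAffine.Point).range)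
    (hloc : ∀ v ∈ S, h1Equiv θ hθ (kummerMapTorsion W' (p : ℤ) hdiv' P) ∈
      selmerLocalKer W (v.adicCompletion K) (p : ℤ)) :
    ∃ c : W.sha, c ≠ 0 ∧ p • c = 0 := by
  have hp : p.Prime := Fact.out
  have hn : (p : ℤ) ≠ 0 := by exact_mod_cast hp.ne_zero
  have hdiv : ∀ P : geomPoints W, ∃ Q : geomPoints W, (p : ℤ) • Q = P :=
    W.zsmul_geomPoints_surjective_holds hn
  obtain ⟨hsha, hpc⟩ :=
    torsionH1ToH1_h1Equiv_kummerMapTorsion_mem_sha W W' hp2 θ hθ S hS hdiv' P hloc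
  -- the Kummer image of `E(K)` is trivial
  have hκ0 : (kummerMapTorsion W (p : ℤ) hdiv).range = ⊥ := by
    rw [AddMonoidHom.range_eq_bot_iff, ← AddMonoidHom.ker_eq_top_iff,
      kummerMapTorsion_ker W (p : ℤ) hdiv, hE]
  refine ⟨⟨_, hsha⟩, fun h ↦ hP ?_, Subtype.ext hpc⟩
  -- `c = 0` forces `θ_* κ'(P) ∈ im κ = 0`, hence `κ'(P) = 0`, hence `P ∈ pE'(K)`
  have h0 : torsionH1ToH1 W (p : ℤ) (h1Equiv θ hθ (kummerMapTorsion W' (p : ℤ) hdiv' P)) = 0 :=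
    congrArg Subtype.val h
  have hrange := mem_range_kummerMapTorsion_of_torsionH1ToH1_eq_zero W (p : ℤ) hdiv _ h0
  rw [hκ0, AddSubgroup.mem_bot, map_eq_zero_iff _ (h1Equiv θ hθ).injective] at hrange
  have hker : P ∈ (kummerMapTorsion W' (p : ℤ) hdiv').ker := hrange
  rwa [kummerMapTorsion_ker W' (p : ℤ) hdiv'] at hker

/-! ## §3 The certificate shape -/

/-- **The certificate shape: a rank-`0`-type curve and ONE locally divisible point of the partner.**
Let `p` be odd, `θ : E'[p] ⥲ E[p]` a `Γ_K`-isomorphism, `S` as above, `E(K)` FINITE of order prime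
to `p`, and `P ∈ E'(K) ∖ pE'(K)`. Suppose that at every `v ∈ S` EITHER `P|_{K_v} = p • Q` for some
`Q ∈ E'(K_v)` (a `p`-th root in Mathlib's `K_v`-points of `W' ⊗ K_v` — criterion (a); no condition
on the reduction of `E`, `E'` at `v`, in particular allowed at `v ∣ p`) OR `v ∤ p` and
`E'(K_v)[p] = 0` (criterion (b): then `#𝓛_v(E') = 1`). Then `Ш(E/K)` has a non-zero element killed
by `p`. Over `ℚ` at `p = 3` with `E` of rank `0`, `3 ∤ #E(ℚ)`, and a `3`-congruent partner `E'`: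
ONE point `P ∈ E'(ℚ) ∖ 3E'(ℚ)` that is `3`-divisible in `E'(ℚ₃)` (and in `E'(ℚ_ℓ)` at any other bad
`ℓ` with `E'(ℚ_ℓ)[3] ≠ 0`), with `E'(ℚ_ℓ)[3] = 0` at the remaining places of `S`, certifies
`Ш(E)[3] ≠ 0` — with NO hypothesis `E'(ℚ₃)[3] = 0` (compare `exists_sha_ne_zero_of_congr_of_rank`,
whose count needs it). -/
theorem exists_sha_ne_zero_of_congr_of_locallyDivisible (hp2 : p ≠ 2)
    (θ : geomTorsion W' (p : ℤ) ≃+ geomTorsion W (p : ℤ))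
    (hθ : ∀ (σ : absoluteGaloisGroup K) (P : geomTorsion W' (p : ℤ)), θ (σ • P) = σ • θ P)
    (S : Finset (HeightOneSpectrum (𝓞 K)))
    (hS : ∀ v : HeightOneSpectrum (𝓞 K), v ∉ S →
      W.HasGoodReductionAt v ∧ W'.HasGoodReductionAt v ∧ (p : 𝓞 K) ∉ v.asIdeal)
    (hfin : Finite W.toAffine.Point) (hcop : (Nat.card W.toAffine.Point).Coprime p)
    (P : W'.toAffine.Point)
    (hP : P ∉ (zsmulAddGroupHom (p : ℤ) : W'.toAffine.Point →+ W'.toAffine.Point).range)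
    (hdiv : ∀ v ∈ S,
      (∃ Q : (W'.baseChange (v.adicCompletion K)).toAffine.Point,
        p • Q = WeierstrassCurve.Affine.Point.baseChange (W' := W') K (v.adicCompletion K) P) ∨
      ((p : 𝓞 K) ∉ v.asIdeal ∧ Nat.card (nsmulAddMonoidHom p :
        (W'.baseChange (v.adicCompletion K)).toAffine.Point →+ _).ker = 1)) :
    ∃ c : W.sha, c ≠ 0 ∧ p • c = 0 := by
  have hp : p.Prime := Fact.out
  have hn : (p : ℤ) ≠ 0 := by exact_mod_cast hp.ne_zero
  have hdiv' : ∀ P : geomPoints W', ∃ Q : geomPoints W', (p : ℤ) • Q = P :=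
    W'.zsmul_geomPoints_surjective_holds hn
  have hE : (zsmulAddGroupHom (p : ℤ) : W.toAffine.Point →+ W.toAffine.Point).range = ⊤ := by
    rw [← AddSubgroup.index_eq_one]
    exact index_range_zsmul_eq_one_of_coprime hcop
  refine exists_sha_ne_zero_of_congr_of_witness W W' hp2 θ hθ S hS hdiv' hE P hP fun v hv ↦ ?_
  rcases hdiv v hv with ⟨Q, hQ⟩ | ⟨hpv, hcard⟩
  · -- criterion (a): a `p`-th root of `P` in `E'(K_v)`
    exact h1Equiv_kummerMapTorsion_mem_selmerLocalKer_of_exists_smul_eq W W' θ hθ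
      (v.adicCompletion K) hn hdiv' P ⟨Q, by rw [natCast_zsmul]; exact hQ⟩
  · -- criterion (b): `v ∤ p` and `E'(K_v)[p] = 0`, so `#𝓛_v(E') = 1`
    refine h1Equiv_kummerMapTorsion_mem_selmerLocalKer_of_natCard_eq_one W W' θ hθ
      (v.adicCompletion K) hdiv' P ?_
    rw [W'.natCard_kummerLocalConditionAt_adicCompletion v hp.ne_zero, hcard, one_mul,
      natCard_quot_adicCompletionIntegers_eq_one hpv]

/-- **The certificate shape with the free kinds of the tree as a third option.** As
`exists_sha_ne_zero_of_congr_of_locallyDivisible`, each place `v ∈ S` being EITHER (a) a place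
where `P|_{K_v}` has a `p`-th root in `E'(K_v)`, OR (c) a place where the local conditions agree
along `θ` (`ι_v(θ) = 1` — supplied by the tree's criteria: `v ∤ p` with `E'(K_v)[p] = 0`
(`relIndex_map_selmerLocalKer_eq_one_of_card_torsion_eq_one`), both curves good at `v ∤ p`
(`…_of_hasGoodReductionAt`), both split multiplicative (`…_of_hasSplitMultiplicativeReductionAt`,
conditional on Tate uniformisation), …). -/
theorem exists_sha_ne_zero_of_congr_of_locallyDivisible_or_relIndex_eq_one (hp2 : p ≠ 2)
    (θ : geomTorsion W' (p : ℤ) ≃+ geomTorsion W (p : ℤ))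
    (hθ : ∀ (σ : absoluteGaloisGroup K) (P : geomTorsion W' (p : ℤ)), θ (σ • P) = σ • θ P)
    (S : Finset (HeightOneSpectrum (𝓞 K)))
    (hS : ∀ v : HeightOneSpectrum (𝓞 K), v ∉ S →
      W.HasGoodReductionAt v ∧ W'.HasGoodReductionAt v ∧ (p : 𝓞 K) ∉ v.asIdeal)
    (hfin : Finite W.toAffine.Point) (hcop : (Nat.card W.toAffine.Point).Coprime p)
    (P : W'.toAffine.Point)
    (hP : P ∉ (zsmulAddGroupHom (p : ℤ) : W'.toAffine.Point →+ W'.toAffine.Point).range)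
    (hdiv : ∀ v ∈ S,
      (∃ Q : (W'.baseChange (v.adicCompletion K)).toAffine.Point,
        p • Q = WeierstrassCurve.Affine.Point.baseChange (W' := W') K (v.adicCompletion K) P) ∨
      (selmerLocalKer W (v.adicCompletion K) (p : ℤ)).relIndex
        ((selmerLocalKer W' (v.adicCompletion K) (p : ℤ)).map (h1Equiv θ hθ).toAddMonoidHom) = 1) :
    ∃ c : W.sha, c ≠ 0 ∧ p • c = 0 := by
  have hp : p.Prime := Fact.out
  have hn : (p : ℤ) ≠ 0 := by exact_mod_cast hp.ne_zero
  have hdiv' : ∀ P : geomPoints W', ∃ Q : geomPoints W', (p : ℤ) • Q = P :=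
    W'.zsmul_geomPoints_surjective_holds hn
  have hE : (zsmulAddGroupHom (p : ℤ) : W.toAffine.Point →+ W.toAffine.Point).range = ⊤ := by
    rw [← AddSubgroup.index_eq_one]
    exact index_range_zsmul_eq_one_of_coprime hcop
  refine exists_sha_ne_zero_of_congr_of_witness W W' hp2 θ hθ S hS hdiv' hE P hP fun v hv ↦ ?_
  rcases hdiv v hv with ⟨Q, hQ⟩ | hone
  · exact h1Equiv_kummerMapTorsion_mem_selmerLocalKer_of_exists_smul_eq W W' θ hθ
      (v.adicCompletion K) hn hdiv' P ⟨Q, by rw [natCast_zsmul]; exact hQ⟩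
  · exact h1Equiv_kummerMapTorsion_mem_selmerLocalKer_of_relIndex_eq_one W W' θ hθ
      (v.adicCompletion K) hdiv' P hone

end Main

end Summit.BirchSwinnertonDyer.Rank1Residual.GaloisImage.VisibleWitness

end
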